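import Literature.Probability.Moments.StochasticTraceEstimator
import Literature.Analysis.Matrix.DeflatedConjugateGradient
import HarnessLib

/-!
# Deflation as variance reduction for the stochastic trace estimator: the exact low-mode part and
# the Gaussian-noise variance `2‖A_R‖_F² = 2 Σ_{non-deflated} λ²`

Topic `Probability/Moments`; sequel of `StochasticTraceEstimator.lean` (Hutchinson / Gaussian trace
estimator `traceEst A z = zᵀAz`, its unbiasedness and exact variance; Avron–Toledo Lemma 5.1:
`Var = 2‖A‖_F²` for symmetric `A` and Gaussian noise) and of
`Literature/Analysis/Matrix/DeflatedConjugateGradient.lean` (the deflated matrix `A π_R` of an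
exact eigenvector deflation and its action on the eigenbasis).  PUBLISHED RESULTS with our proofs;
no named fact (`def … : Prop`) is introduced (D-0026).  Wanted by the cell pub-lqcd (venture
`LatticeQCDFlow`; HOME/R2-SCOPE.md §2 (low-mode deflation for reweighting, arXiv:2306.02385),
§3 N2 / E9 ("Hutchinson probes" for `Tr ln M` differences and reweighting factors); FANOUT row 38).

## Source (read on the materialised text) and what is taken from it

A. S. Gambhir, A. Stathopoulos, K. Orginos, *Deflation as a method of variance reduction for
estimating the trace of a matrix inverse*, SIAM J. Sci. Comput. 39 (2017) A532–A558 =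
arXiv:1603.05988 [GambhirStathopoulosOrginos2017] (held text `paper:arxiv-1603.05988`):
* §1 eq. (1.1)–(1.2) (chunk p0003): the Hutchinson estimator
  `t(A⁻¹) = (1/s) Σ_j z_jᴴ A⁻¹ z_j`, `E(t(A⁻¹)) = Tr(A⁻¹)`, and "the variance for vectors with
  elements following a Gaussian distribution is `2‖A⁻¹‖_F²`";
* §2 eq. (2.1) and the text after it (chunk p0005): "for variance reduction for `Tr(A)` we remove
  the largest magnitude [eigenvalues] … `A = U₁Σ₁V₁ᴴ + U₂Σ₂V₂ᴴ ≡ A_D + A_R` (2.1) and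
  `Tr(A) = Tr(A_D) + Tr(A_R)`. If the triplet `U₁, V₁, Σ₁` has been pre-computed … we can
  explicitly compute `Tr(A_D) = Tr(Σ₁V₁ᴴU₁)` … What remains is to compute `Tr(A_R)`, the trace
  of our matrix projected on the remaining singular vectors, `A_R = A(I − V₁V₁ᴴ)`. This can be
  estimated stochastically";
* proof of Theorem 2.1, eq. (2.7) (chunk p0005): "From the properties of the SVD we have
  `‖A‖_F² = Σ_{i=1}^N σ_i²` … `‖A_R‖_F² = Σ_{i=k+1}^N σ_i²`".
(Theorem 2.1 itself — the `ℤ₄`-noise variance with the diagonal `Δ`-terms — is NOT formalised;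
this file is its Gaussian-noise, Hermitian special case, where the diagonal terms are absent and
the eigen-decomposition is the SVD up to signs.)

## What is formalised (real symmetric `A`, exact eigenvector deflation; all proved)

With `V = eigMatrix hA e` (columns = the deflated orthonormal eigenvectors `q_{e j}`, `e` injective,
deflated eigenvalues non-zero) the tree's deflated matrix `A π_R` of
`DeflatedConjugateGradient.lean` acts on the eigenbasis exactly as `A_R = A(I − V₁V₁ᴴ)` of (2.1)
(`deflated_mulVec_eigenvector`: `0` on the deflated eigenvectors, `λ_l` on the others), and:
* `sum_sq_entries_eq_sum_sq` / `trace_eq_sum` — eigenbasis bookkeeping: a symmetric `M` acting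
  diagonally on an orthonormal eigenbasis, `M q_l = c_l q_l`, has `Σ_{ij} M_ij² = Σ_l c_l²` and
  `tr M = Σ_l c_l` ("from the properties of the SVD");
* `trace_eq_trace_deflated_add` — **`Tr(A) = Tr(A_R) + Σ_j λ_{e j}`** (the exact part
  `Tr(A_D)` is the sum of the deflated eigenvalues);
* `sum_sq_deflated`, `sum_sq_eq_sum_sq_deflated_add` — **`‖A_R‖_F² = Σ_{l ∉ deflated} λ_l²
  = ‖A‖_F² − Σ_j λ_{e j}²`** (2.7);
* `integral_traceEst_deflated_add` — the deflated estimator plus the exact part is unbiased for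
  `Tr A`; `variance_traceEst_gaussian_deflated`, **`variance_gaussian_sub_deflated`** — with
  Gaussian noise `Var(t(A_R)) = 2 Σ_{l ∉ deflated} λ_l² = Var(t(A)) − 2 Σ_j λ_{e j}²`: deflating
  the largest-magnitude eigenvalues (the LOW modes of the Dirac operator when `A = (D†D)⁻¹`-type)
  removes exactly their contribution from the variance.

HONEST SCOPE: real symmetric matrices and real Gaussian noise (the `ℤ₂`/`ℤ₄` and complex cases of
the paper carry extra diagonal terms — Theorem 2.1 — not typed); exact eigenvectors only (no SVD of
a non-Hermitian `A`, no inexact deflation); single probe (the `1/s` of `s` probes is the generic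
i.i.d. average, not restated); nothing numerical.

## References
* [GambhirStathopoulosOrginos2017] A. S. Gambhir, A. Stathopoulos, K. Orginos, SIAM J. Sci.
  Comput. 39 (2017) A532–A558, arXiv:1603.05988: §1 (1.1)–(1.2) and the Gaussian-variance
  sentence; §2 (2.1), (2.7).
* [AvronToledo2011] H. Avron, S. Toledo, J. ACM 58 (2011) Art. 8, Lemma 5.1 (through
  `StochasticTraceEstimator.lean`).
-/

noncomputable section

open scoped Matrix
open Finset MeasureTheory ProbabilityTheory

namespace Literature.Probability.Moments

namespace DeflatedTrace

open _root_.Matrix Literature.LinearAlgebra.Matrix.Deflation Literature.Analysis.Matrix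
  Literature.Analysis.Matrix.ConjugateGradient Literature.Probability.Moments.StochasticTrace

variable {ι k : Type*} [Fintype ι] [Fintype k] [DecidableEq ι] [DecidableEq k]

/-! ## §1 Eigenbasis bookkeeping: `‖M‖_F²` and `tr M` of a matrix diagonal on an orthonormal
eigenbasis -/

section Bookkeeping

variable {W M : Matrix ι ι ℝ}

omit [Fintype k] [DecidableEq k] in
/-- `q_l ⬝ (M v) = c_l (q_l ⬝ v)` for symmetric `M` with `M q_l = c_l q_l`. [folklore] -/
private theorem eigen_dotProduct_mulVec_of (hW : W.IsHermitian) (hM : Mᵀ = M) {c : ι → ℝ}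
    (hc : ∀ l, M *ᵥ (hW.eigenvectorBasis l).ofLp = c l • (hW.eigenvectorBasis l).ofLp)
    (l : ι) (v : ι → ℝ) :
    (hW.eigenvectorBasis l).ofLp ⬝ᵥ (M *ᵥ v) = c l * ((hW.eigenvectorBasis l).ofLp ⬝ᵥ v) := by
  rw [dotProduct_mulVec, ← mulVec_transpose, hM, hc l, smul_dotProduct, smul_eq_mul]

omit [Fintype k] [DecidableEq k] in
/-- `‖M v‖² = Σ_l c_l² (q_l ⬝ v)²` for symmetric `M` diagonal on the orthonormal eigenbasis `q`.
[cite: GambhirStathopoulosOrginos2017, §2 proof of Theorem 2.1 ("From the properties of the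
SVD")] -/
theorem mulVec_dotProduct_mulVec_eq_sum (hW : W.IsHermitian) (hM : Mᵀ = M) {c : ι → ℝ}
    (hc : ∀ l, M *ᵥ (hW.eigenvectorBasis l).ofLp = c l • (hW.eigenvectorBasis l).ofLp)
    (v : ι → ℝ) :
    (M *ᵥ v) ⬝ᵥ (M *ᵥ v) = ∑ l, c l ^ 2 * ((hW.eigenvectorBasis l).ofLp ⬝ᵥ v) ^ 2 := by
  rw [KyFan.dotProduct_self_eq_sum_sq hW (M *ᵥ v)]
  exact sum_congr rfl fun l _ => by rw [eigen_dotProduct_mulVec_of hW hM hc, mul_pow]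

omit [Fintype k] [DecidableEq k] in
/-- **`‖M‖_F² = Σ_l c_l²`**: the sum of the squared entries of a symmetric matrix acting as
`M q_l = c_l q_l` on an orthonormal eigenbasis is the sum of the squared eigenvalues
("`‖A‖_F² = Σ σ_i²` … `‖A_R‖_F² = Σ_{i>k} σ_i²`"). [cite: GambhirStathopoulosOrginos2017, §2
eq. (2.7)] -/
theorem sum_sq_entries_eq_sum_sq (hW : W.IsHermitian) (hM : Mᵀ = M) {c : ι → ℝ}
    (hc : ∀ l, M *ᵥ (hW.eigenvectorBasis l).ofLp = c l • (hW.eigenvectorBasis l).ofLp) :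
    ∑ i, ∑ j, M i j ^ 2 = ∑ l, c l ^ 2 := by
  -- row `i` of `M` is the column `M e_i` (symmetry), and `‖M e_i‖² = Σ_l c_l² q_l(i)²`
  have hsym : ∀ i j, M j i = M i j := fun i j => by
    have h := congrFun (congrFun hM i) j
    rwa [transpose_apply] at h
  have hrow : ∀ i, ∑ j, M i j ^ 2 = (M *ᵥ Pi.single i 1) ⬝ᵥ (M *ᵥ Pi.single i 1) := by
    intro i
    rw [mulVec_single_one]
    unfold dotProduct
    refine sum_congr rfl fun j _ => ?_
    rw [Matrix.col_apply, hsym i j, sq]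
  have hqe : ∀ l i, (hW.eigenvectorBasis l).ofLp ⬝ᵥ Pi.single i 1 = (hW.eigenvectorBasis l).ofLp i := by
    intro l i
    rw [dotProduct_comm, single_one_dotProduct]
  simp_rw [hrow, mulVec_dotProduct_mulVec_eq_sum hW hM hc, hqe]
  rw [sum_comm]
  refine sum_congr rfl fun l _ => ?_
  rw [← mul_sum]
  have h1 : ∑ i, (hW.eigenvectorBasis l).ofLp i ^ 2 = 1 := by
    have h := KyFan.eigenvectorBasis_dotProduct hW l l
    rw [if_pos rfl] at h
    rw [← h]
    unfold dotProduct
    exact sum_congr rfl fun i _ => sq _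
  rw [h1, mul_one]

omit [Fintype k] [DecidableEq k] in
/-- **`tr M = Σ_l c_l`** for a symmetric `M` with `M q_l = c_l q_l` on an orthonormal eigenbasis
("`Tr(A_D) = Tr(Σ₁V₁ᴴU₁)`", i.e. the sum of the deflated (singular) values in the Hermitian
case). [cite: GambhirStathopoulosOrginos2017, §2 eq. (2.1) and the sentence after it] -/
theorem trace_eq_sum (hW : W.IsHermitian) (hM : Mᵀ = M) {c : ι → ℝ}
    (hc : ∀ l, M *ᵥ (hW.eigenvectorBasis l).ofLp = c l • (hW.eigenvectorBasis l).ofLp) :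
    M.trace = ∑ l, c l := by
  -- `M_ii = (M e_i)_i = Σ_l c_l q_l(i)²`
  have hdiag : ∀ i, M i i = ∑ l, c l * (hW.eigenvectorBasis l).ofLp i ^ 2 := by
    intro i
    have hcol : M i i = (M *ᵥ Pi.single i 1) i := by rw [mulVec_single_one, Matrix.col_apply]
    rw [hcol]
    conv_lhs => rw [KyFan.eq_sum_dotProduct_smul hW (M *ᵥ Pi.single i 1)]
    rw [Finset.sum_apply]
    refine sum_congr rfl fun l _ => ?_
    rw [Pi.smul_apply, smul_eq_mul, eigen_dotProduct_mulVec_of hW hM hc, dotProduct_comm,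
      single_one_dotProduct]
    ring
  unfold Matrix.trace
  simp_rw [Matrix.diag_apply, hdiag]
  rw [sum_comm]
  refine sum_congr rfl fun l _ => ?_
  rw [← mul_sum]
  have h1 : ∑ i, (hW.eigenvectorBasis l).ofLp i ^ 2 = 1 := by
    have h := KyFan.eigenvectorBasis_dotProduct hW l l
    rw [if_pos rfl] at h
    rw [← h]
    unfold dotProduct
    exact sum_congr rfl fun i _ => sq _
  rw [h1, mul_one]

end Bookkeeping

/-! ## §2 Exact eigenvector deflation: `Tr(A) = Tr(A_R) + Σ λ_deflated`,
`‖A_R‖_F² = ‖A‖_F² − Σ λ_deflated²` -/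

section Deflated

variable {A : Matrix ι ι ℝ}

/-- **The deflated spectrum**: on the eigenbasis, `A_R = A π_R` acts as `0` on the deflated
eigenvectors and as `λ_l` on the others. [cite: GambhirStathopoulosOrginos2017, §2 eq. (2.1)
(`A_R = A(I − V₁V₁ᴴ) = U₂Σ₂V₂ᴴ`)] -/
theorem deflated_mulVec_eigenvector (hA : A.IsHermitian) {e : k → ι} (he : Function.Injective e)
    (hne : ∀ j, hA.eigenvalues (e j) ≠ 0) (l : ι) :
    (A * piR A (eigMatrix hA e) (eigMatrix hA e)ᵀ) *ᵥ (hA.eigenvectorBasis l).ofLp =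
      (if l ∈ Set.range e then 0 else hA.eigenvalues l) • (hA.eigenvectorBasis l).ofLp := by
  by_cases hl : l ∈ Set.range e
  · obtain ⟨j, rfl⟩ := hl
    rw [if_pos ⟨j, rfl⟩, zero_smul]
    exact mul_piR_mulVec_eigenvector_deflated hA he hne j
  · rw [if_neg hl]
    exact mul_piR_mulVec_eigenvector hA e hl

/-- The deflated matrix of a symmetric matrix is symmetric (`A_R = A π_R = π_Rᵀ A π_R`).
[cite: GambhirStathopoulosOrginos2017, §2 eq. (2.1) (Hermitian case)] -/
theorem transpose_deflated (hA : A.IsHermitian) {e : k → ι} (he : Function.Injective e)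
    (hne : ∀ j, hA.eigenvalues (e j) ≠ 0) :
    (A * piR A (eigMatrix hA e) (eigMatrix hA e)ᵀ)ᵀ = A * piR A (eigMatrix hA e) (eigMatrix hA e)ᵀ := by
  have h := (ConjugateGradient.isHermitian_mul_piR (isUnit_littleOp_eigMatrix hA he hne) hA).eq
  rwa [conjTranspose_eq_transpose_of_trivial] at h

omit [DecidableEq k] in
/-- A sum over all indices splits into the deflated ones (re-indexed by `j : k` through the
injective selection `e`) and the rest. [folklore] -/
private theorem sum_ite_range_add {e : k → ι} (he : Function.Injective e) (f : ι → ℝ) :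
    ∑ l, (if l ∈ Set.range e then 0 else f l) + ∑ j, f (e j) = ∑ l, f l := by
  classical
  have hsplit := (sum_filter_add_sum_filter_not (univ : Finset ι) (fun l => l ∈ Set.range e) f)
  have hdefl : ∑ l ∈ univ.filter (fun l => l ∈ Set.range e), f l = ∑ j, f (e j) := by
    rw [show univ.filter (fun l => l ∈ Set.range e) = univ.image e by
      ext l; simp [Set.mem_range, eq_comm]]
    rw [sum_image fun j _ j' _ h => he h]
  have hrest : ∑ l ∈ univ.filter (fun l => ¬ l ∈ Set.range e), f l =
      ∑ l, (if l ∈ Set.range e then 0 else f l) := by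
    rw [sum_filter]
    exact sum_congr rfl fun l _ => by by_cases h : l ∈ Set.range e <;> simp [h]
  rw [← hsplit, hdefl, hrest, add_comm]

/-- **`Tr(A_R) = Σ_{l not deflated} λ_l`.** [cite: GambhirStathopoulosOrginos2017, §2 eq. (2.1)
and the sentence after it (`Tr(A) = Tr(A_D) + Tr(A_R)`)] -/
theorem trace_deflated (hA : A.IsHermitian) {e : k → ι} (he : Function.Injective e)
    (hne : ∀ j, hA.eigenvalues (e j) ≠ 0) :
    (A * piR A (eigMatrix hA e) (eigMatrix hA e)ᵀ).trace =
      ∑ l, (if l ∈ Set.range e then 0 else hA.eigenvalues l) :=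
  trace_eq_sum hA (transpose_deflated hA he hne) (deflated_mulVec_eigenvector hA he hne)

/-- **`Tr(A) = Tr(A_R) + Tr(A_D)` with the exact part `Tr(A_D) = Σ_j λ_{e j}`** — the
deflated eigenvalues are summed exactly, only `Tr(A_R)` is left to the stochastic estimator.
[cite: GambhirStathopoulosOrginos2017, §2 eq. (2.1) and the sentence after it] -/
theorem trace_eq_trace_deflated_add (hA : A.IsHermitian) {e : k → ι} (he : Function.Injective e)
    (hne : ∀ j, hA.eigenvalues (e j) ≠ 0) :
    A.trace = (A * piR A (eigMatrix hA e) (eigMatrix hA e)ᵀ).trace + ∑ j, hA.eigenvalues (e j) := by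
  rw [trace_deflated hA he hne, sum_ite_range_add he,
    trace_eq_sum hA (KyFan.transpose_eq hA) (fun l => hA.mulVec_eigenvectorBasis l)]

/-- **`‖A_R‖_F² = Σ_{l not deflated} λ_l²`** (2.7). [cite: GambhirStathopoulosOrginos2017, §2
eq. (2.7) (`‖A_R‖_F² = Σ_{i=k+1}^N σ_i²`)] -/
theorem sum_sq_deflated (hA : A.IsHermitian) {e : k → ι} (he : Function.Injective e)
    (hne : ∀ j, hA.eigenvalues (e j) ≠ 0) :
    ∑ i, ∑ j, (A * piR A (eigMatrix hA e) (eigMatrix hA e)ᵀ) i j ^ 2 =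
      ∑ l, (if l ∈ Set.range e then 0 else hA.eigenvalues l) ^ 2 := by
  rw [sum_sq_entries_eq_sum_sq hA (transpose_deflated hA he hne)
    (deflated_mulVec_eigenvector hA he hne)]

/-- **`‖A‖_F² = ‖A_R‖_F² + Σ_j λ_{e j}²`** ("`‖A‖_F² = Σ_{i=1}^N σ_i²`, `‖A_R‖_F² = Σ_{i>k} σ_i²`").
[cite: GambhirStathopoulosOrginos2017, §2 eq. (2.7)] -/
theorem sum_sq_eq_sum_sq_deflated_add (hA : A.IsHermitian) {e : k → ι}
    (he : Function.Injective e) (hne : ∀ j, hA.eigenvalues (e j) ≠ 0) :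
    ∑ i, ∑ j, A i j ^ 2 =
      ∑ i, ∑ j, (A * piR A (eigMatrix hA e) (eigMatrix hA e)ᵀ) i j ^ 2 +
        ∑ j, hA.eigenvalues (e j) ^ 2 := by
  rw [sum_sq_deflated hA he hne,
    sum_sq_entries_eq_sum_sq hA (KyFan.transpose_eq hA) (fun l => hA.mulVec_eigenvectorBasis l)]
  have h := sum_ite_range_add he fun l => hA.eigenvalues l ^ 2
  rw [← h]
  congr 1
  exact sum_congr rfl fun l _ => by by_cases hl : l ∈ Set.range e <;> simp [hl]

end Deflated

/-! ## §3 The stochastic estimator: unbiased split and the Gaussian variance reduction -/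

section Estimator

variable {A : Matrix ι ι ℝ}

/-- **Unbiasedness of the deflated estimator plus the exact part**: for any unit noise,
`E[zᵀ A_R z] + Σ_j λ_{e j} = Tr(A)` ("`Tr(A) = Tr(A_D) + Tr(A_R)` … `Tr(A_R)` … can be estimated
stochastically"). [cite: GambhirStathopoulosOrginos2017, §1 eq. (1.2) (`E(t(A⁻¹)) = Tr(A⁻¹)`) with
§2 eq. (2.1)] -/
theorem integral_traceEst_deflated_add {μ : Measure ℝ} [IsProbabilityMeasure μ]
    (hμ : IsUnitNoise μ) (hA : A.IsHermitian) {e : k → ι} (he : Function.Injective e)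
    (hne : ∀ j, hA.eigenvalues (e j) ≠ 0) :
    ∫ z, traceEst (A * piR A (eigMatrix hA e) (eigMatrix hA e)ᵀ) z ∂(Measure.pi fun _ : ι => μ) +
        ∑ j, hA.eigenvalues (e j) = A.trace := by
  rw [integral_traceEst hμ, ← trace_eq_trace_deflated_add hA he hne]

/-- **Gaussian-noise variance of the plain estimator in spectral form**: `Var(zᵀAz) = 2‖A‖_F² =
2 Σ_l λ_l²` for symmetric `A`. [cite: GambhirStathopoulosOrginos2017, §1 ("the variance for
vectors with elements following a Gaussian distribution is `2‖A⁻¹‖_F²`") with §2 eq. (2.7);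
AvronToledo2011, Lemma 5.1] -/
theorem variance_traceEst_gaussian_eq_sum_eigenvalues (hA : A.IsHermitian) :
    ∫ z, (traceEst A z - A.trace) ^ 2 ∂(Measure.pi fun _ : ι => gaussianReal 0 1) =
      2 * ∑ l, hA.eigenvalues l ^ 2 := by
  rw [variance_traceEst_gaussian_symm (KyFan.transpose_eq hA),
    sum_sq_entries_eq_sum_sq hA (KyFan.transpose_eq hA) (fun l => hA.mulVec_eigenvectorBasis l)]

/-- **Gaussian-noise variance of the DEFLATED estimator**: `Var(zᵀA_R z) = 2‖A_R‖_F² =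
2 Σ_{l not deflated} λ_l²`. [cite: GambhirStathopoulosOrginos2017, §1 (Gaussian variance
`2‖·‖_F²`) with §2 eq. (2.7) (`‖A_R‖_F² = Σ_{i>k} σ_i²`)] -/
theorem variance_traceEst_gaussian_deflated (hA : A.IsHermitian) {e : k → ι}
    (he : Function.Injective e) (hne : ∀ j, hA.eigenvalues (e j) ≠ 0) :
    ∫ z, (traceEst (A * piR A (eigMatrix hA e) (eigMatrix hA e)ᵀ) z -
        (A * piR A (eigMatrix hA e) (eigMatrix hA e)ᵀ).trace) ^ 2
          ∂(Measure.pi fun _ : ι => gaussianReal 0 1) =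
      2 * ∑ l, (if l ∈ Set.range e then 0 else hA.eigenvalues l) ^ 2 := by
  rw [variance_traceEst_gaussian_symm (transpose_deflated hA he hne), sum_sq_deflated hA he hne]

/-- **Deflation as variance reduction (Gaussian noise)**: the variance of the plain estimator
exceeds that of the deflated one by exactly twice the sum of the squared deflated eigenvalues,
`Var(zᵀAz) − Var(zᵀA_R z) = 2 Σ_j λ_{e j}² ≥ 0` — removing the largest-magnitude eigenvalues
(the low modes of the Dirac operator for `A = (D†D)⁻¹`-type functions) removes their contribution
to the noise. [cite: GambhirStathopoulosOrginos2017, §1–§2 ("for variance reduction for `Tr(A)` we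
remove the largest magnitude"), eq. (2.7)] -/
theorem variance_gaussian_sub_deflated (hA : A.IsHermitian) {e : k → ι}
    (he : Function.Injective e) (hne : ∀ j, hA.eigenvalues (e j) ≠ 0) :
    ∫ z, (traceEst A z - A.trace) ^ 2 ∂(Measure.pi fun _ : ι => gaussianReal 0 1) -
      ∫ z, (traceEst (A * piR A (eigMatrix hA e) (eigMatrix hA e)ᵀ) z -
        (A * piR A (eigMatrix hA e) (eigMatrix hA e)ᵀ).trace) ^ 2
          ∂(Measure.pi fun _ : ι => gaussianReal 0 1) =
      2 * ∑ j, hA.eigenvalues (e j) ^ 2 := by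
  rw [variance_traceEst_gaussian_eq_sum_eigenvalues hA, variance_traceEst_gaussian_deflated hA he hne,
    ← sum_ite_range_add he (fun l => hA.eigenvalues l ^ 2)]
  have h : ∑ l, (if l ∈ Set.range e then 0 else hA.eigenvalues l) ^ 2 =
      ∑ l, (if l ∈ Set.range e then 0 else hA.eigenvalues l ^ 2) :=
    sum_congr rfl fun l _ => by by_cases hl : l ∈ Set.range e <;> simp [hl]
  rw [h]
  ring

/-- The deflated Gaussian estimator never has larger variance than the plain one.
[cite: GambhirStathopoulosOrginos2017, §2 ("one would expect that the variance on `A_R` will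
always be smaller" — true in the Hermitian/Gaussian case), eq. (2.7)] -/
theorem variance_gaussian_deflated_le (hA : A.IsHermitian) {e : k → ι}
    (he : Function.Injective e) (hne : ∀ j, hA.eigenvalues (e j) ≠ 0) :
    ∫ z, (traceEst (A * piR A (eigMatrix hA e) (eigMatrix hA e)ᵀ) z -
        (A * piR A (eigMatrix hA e) (eigMatrix hA e)ᵀ).trace) ^ 2
          ∂(Measure.pi fun _ : ι => gaussianReal 0 1) ≤
      ∫ z, (traceEst A z - A.trace) ^ 2 ∂(Measure.pi fun _ : ι => gaussianReal 0 1) := by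
  have h := variance_gaussian_sub_deflated hA he hne
  have hnn : 0 ≤ 2 * ∑ j, hA.eigenvalues (e j) ^ 2 :=
    mul_nonneg zero_le_two (sum_nonneg fun j _ => sq_nonneg _)
  linarith

end Estimator

end DeflatedTrace

end Literature.Probability.Moments

end
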